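import Summits.Ventures.PercRepro.RankLevelSetRuleQConvThirtyThreeData

/-!
# PercRepro — the depth-33 Gauss convergent of the master sum `S(q,m)` as a super-solution of its recurrence, certified by
Kronecker polynomial identity testing (p4, gen 27; C-044; paper proofs/P4-CELL-THREE.md §13.3, §13.6)

`C_33 = cfThirtyThreeN / cfThirtyThreeD` is the depth-33 convergent of the Gauss continued fraction of `S(q,m) = ₂F₁(−m,1;q+1;−1)`, reduced by its
common factor.  `cfThirtyThree_step`: it is a super-solution of the recurrence `(q+m+1)·S(q,m+1) = 2(m+1)·S(q,m) + q` — the defect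
polynomial `cfThirtyThreeStep` (an exact polynomial identity, `cfThirtyThree_step_eq`) vanishes identically for `m < 15` and is a polynomial with
1139 non-negative coefficients in `(q − m − 1, m − 15)` beyond; `cfThirtyThreeD_pos`: the denominator is positive for `m + 1 ≤ q`
(`cfThirtyThree_D_shift`: 514 non-negative coefficients in `(q − m − 1, m)`, constant term `127318455313080538113870809102548992000000`); `cfThirtyThree_zero`: `C_33(q,0) = 1 = S(q,0)`.
**`sumS_le_cfThirtyThree`**: `S(q,m) ≤ C_33(q,m)` for `m + 1 ≤ q`, by induction on `m`.
Every polynomial identity is ONE evaluation at a Kronecker point (`PercRepro.PIT.pitE`); every polynomial is flat data.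
No `sorry`; axioms standard.
-/

namespace PercRepro

open PIT
/-- expression (left side) of `cfThirtyThree_D_shift`. -/
def cfThirtyThreeEcfThirtyThree_D_shift : PExpr := (.comp cfThirtyThreeDData (.add (.add .va .vb) (.const (1))) .vb)

/-- expression (right side) of `cfThirtyThree_D_shift`. -/
def cfThirtyThreeFcfThirtyThree_D_shift : PExpr := (.leaf cfThirtyThreeDAb)

set_option maxHeartbeats 4000000 in
/-- `D(a + b + 1, b)` as the shifted data. -/
lemma cfThirtyThree_D_shift (a b : ℚ) : cfThirtyThreeD (a + b + 1) b = evalP a b cfThirtyThreeDAb := by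
  have h := pitE 147 51 cfThirtyThreeEcfThirtyThree_D_shift cfThirtyThreeFcfThirtyThree_D_shift (by decide +kernel) (by decide +kernel) (by decide +kernel) (by decide +kernel)
  simpa [evalE, cfThirtyThreeEcfThirtyThree_D_shift, cfThirtyThreeFcfThirtyThree_D_shift, cfThirtyThreeD] using h a b

/-- The denominator is positive for `0 ≤ m`, `m + 1 ≤ q`. -/
lemma cfThirtyThreeD_pos (q m : ℚ) (hm : 0 ≤ m) (hq : m + 1 ≤ q) : 0 < cfThirtyThreeD q m := by
  have h := cfThirtyThree_D_shift (q - m - 1) m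
  rw [show q - m - 1 + m + 1 = q by ring] at h
  rw [h]
  unfold cfThirtyThreeDAb
  exact evalP_pos cfThirtyThreeDAbRest 127318455313080538113870809102548992000000 (by norm_num) (by decide +kernel) _ _ (by linarith) hm

/-- expression (left side) of `cfThirtyThree_zero`. -/
def cfThirtyThreeEcfThirtyThree_zero : PExpr := (.comp cfThirtyThreeNData .va (.const (0)))

/-- expression (right side) of `cfThirtyThree_zero`. -/
def cfThirtyThreeFcfThirtyThree_zero : PExpr := (.comp cfThirtyThreeDData .va (.const (0)))

set_option maxHeartbeats 4000000 in
/-- `C_33(q, 0) = 1`: numerator and denominator agree at `m = 0`. -/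
lemma cfThirtyThree_zero (q : ℚ) : cfThirtyThreeN q 0 = cfThirtyThreeD q 0 := by
  have h := pitE 140 1 cfThirtyThreeEcfThirtyThree_zero cfThirtyThreeFcfThirtyThree_zero (by decide +kernel) (by decide +kernel) (by decide +kernel) (by decide +kernel)
  simpa [evalE, cfThirtyThreeEcfThirtyThree_zero, cfThirtyThreeFcfThirtyThree_zero, cfThirtyThreeN, cfThirtyThreeD] using h q 0

/-- expression (left side) of `cfThirtyThree_step_eq`. -/
def cfThirtyThreeEcfThirtyThree_step_eq : PExpr := (.add (.mul (.mul (.add (.add .va .vb) (.const (1))) (.comp cfThirtyThreeNData .va (.add .vb (.const (1))))) (.leaf cfThirtyThreeDData)) (.neg (.mul (.add (.mul (.mul (.const (2)) (.add .vb (.const (1)))) (.leaf cfThirtyThreeNData)) (.mul .va (.leaf cfThirtyThreeDData))) (.comp cfThirtyThreeDData .va (.add .vb (.const (1)))))))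

/-- expression (right side) of `cfThirtyThree_step_eq`. -/
def cfThirtyThreeFcfThirtyThree_step_eq : PExpr := (.leaf cfThirtyThreeStepData)

set_option maxHeartbeats 4000000 in
/-- The defect of the recurrence step of `C_33` is the polynomial `cfThirtyThreeStep`. -/
lemma cfThirtyThree_step_eq (q m : ℚ) : (q + m + 1) * cfThirtyThreeN q (m + 1) * cfThirtyThreeD q m - (2 * (m + 1) * cfThirtyThreeN q m + q * cfThirtyThreeD q m) * cfThirtyThreeD q (m + 1) = cfThirtyThreeStep q m := by
  have h := pitE 280 35 cfThirtyThreeEcfThirtyThree_step_eq cfThirtyThreeFcfThirtyThree_step_eq (by decide +kernel) (by decide +kernel) (by decide +kernel) (by decide +kernel)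
  have h' := h q m
  simp only [evalE, cfThirtyThreeEcfThirtyThree_step_eq, cfThirtyThreeFcfThirtyThree_step_eq, Int.cast_one, Int.cast_ofNat] at h'
  simp only [cfThirtyThreeN, cfThirtyThreeD, cfThirtyThreeStep]
  linear_combination h'

/-- expression (left side) of `cfThirtyThree_step_shift`. -/
def cfThirtyThreeEcfThirtyThree_step_shift : PExpr := (.comp cfThirtyThreeStepData (.add (.add .va .vb) (.const (16))) (.add .vb (.const (15))))

/-- expression (right side) of `cfThirtyThree_step_shift`. -/
def cfThirtyThreeFcfThirtyThree_step_shift : PExpr := (.leaf cfThirtyThreeStepAb)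

set_option maxHeartbeats 4000000 in
/-- The defect shifted to `(a, b) = (q − m − 1, m − 15)` is the non-negative data. -/
lemma cfThirtyThree_step_shift (a b : ℚ) : cfThirtyThreeStep (a + b + 16) (b + 15) = evalP a b cfThirtyThreeStepAb := by
  have h := pitE 284 68 cfThirtyThreeEcfThirtyThree_step_shift cfThirtyThreeFcfThirtyThree_step_shift (by decide +kernel) (by decide +kernel) (by decide +kernel) (by decide +kernel)
  simpa [evalE, cfThirtyThreeEcfThirtyThree_step_shift, cfThirtyThreeFcfThirtyThree_step_shift, cfThirtyThreeStep] using h a b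

/-- expression (left side) of `cfThirtyThree_step_zero0`. -/
def cfThirtyThreeEcfThirtyThree_step_zero0 : PExpr := (.comp cfThirtyThreeStepData .va (.const (0)))

/-- expression (right side) of `cfThirtyThree_step_zero0`. -/
def cfThirtyThreeFcfThirtyThree_step_zero0 : PExpr := (.leaf [])

set_option maxHeartbeats 4000000 in
/-- The defect vanishes identically at `m = 0`. -/
lemma cfThirtyThree_step_zero0 (q : ℚ) : cfThirtyThreeStep q 0 = 0 := by
  have h := pitE 1 1 cfThirtyThreeEcfThirtyThree_step_zero0 cfThirtyThreeFcfThirtyThree_step_zero0 (by decide +kernel) (by decide +kernel) (by decide +kernel) (by decide +kernel)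
  simpa [evalE, evalP, cfThirtyThreeEcfThirtyThree_step_zero0, cfThirtyThreeFcfThirtyThree_step_zero0, cfThirtyThreeStep] using h q 0

/-- expression (left side) of `cfThirtyThree_step_zero1`. -/
def cfThirtyThreeEcfThirtyThree_step_zero1 : PExpr := (.comp cfThirtyThreeStepData .va (.const (1)))

/-- expression (right side) of `cfThirtyThree_step_zero1`. -/
def cfThirtyThreeFcfThirtyThree_step_zero1 : PExpr := (.leaf [])

set_option maxHeartbeats 4000000 in
/-- The defect vanishes identically at `m = 1`. -/
lemma cfThirtyThree_step_zero1 (q : ℚ) : cfThirtyThreeStep q 1 = 0 := by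
  have h := pitE 194 1 cfThirtyThreeEcfThirtyThree_step_zero1 cfThirtyThreeFcfThirtyThree_step_zero1 (by decide +kernel) (by decide +kernel) (by decide +kernel) (by decide +kernel)
  simpa [evalE, evalP, cfThirtyThreeEcfThirtyThree_step_zero1, cfThirtyThreeFcfThirtyThree_step_zero1, cfThirtyThreeStep] using h q 0

/-- expression (left side) of `cfThirtyThree_step_zero2`. -/
def cfThirtyThreeEcfThirtyThree_step_zero2 : PExpr := (.comp cfThirtyThreeStepData .va (.const (2)))

/-- expression (right side) of `cfThirtyThree_step_zero2`. -/
def cfThirtyThreeFcfThirtyThree_step_zero2 : PExpr := (.leaf [])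

set_option maxHeartbeats 4000000 in
/-- The defect vanishes identically at `m = 2`. -/
lemma cfThirtyThree_step_zero2 (q : ℚ) : cfThirtyThreeStep q 2 = 0 := by
  have h := pitE 198 1 cfThirtyThreeEcfThirtyThree_step_zero2 cfThirtyThreeFcfThirtyThree_step_zero2 (by decide +kernel) (by decide +kernel) (by decide +kernel) (by decide +kernel)
  simpa [evalE, evalP, cfThirtyThreeEcfThirtyThree_step_zero2, cfThirtyThreeFcfThirtyThree_step_zero2, cfThirtyThreeStep] using h q 0

/-- expression (left side) of `cfThirtyThree_step_zero3`. -/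
def cfThirtyThreeEcfThirtyThree_step_zero3 : PExpr := (.comp cfThirtyThreeStepData .va (.const (3)))

/-- expression (right side) of `cfThirtyThree_step_zero3`. -/
def cfThirtyThreeFcfThirtyThree_step_zero3 : PExpr := (.leaf [])

set_option maxHeartbeats 4000000 in
/-- The defect vanishes identically at `m = 3`. -/
lemma cfThirtyThree_step_zero3 (q : ℚ) : cfThirtyThreeStep q 3 = 0 := by
  have h := pitE 203 1 cfThirtyThreeEcfThirtyThree_step_zero3 cfThirtyThreeFcfThirtyThree_step_zero3 (by decide +kernel) (by decide +kernel) (by decide +kernel) (by decide +kernel)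
  simpa [evalE, evalP, cfThirtyThreeEcfThirtyThree_step_zero3, cfThirtyThreeFcfThirtyThree_step_zero3, cfThirtyThreeStep] using h q 0

/-- expression (left side) of `cfThirtyThree_step_zero4`. -/
def cfThirtyThreeEcfThirtyThree_step_zero4 : PExpr := (.comp cfThirtyThreeStepData .va (.const (4)))

/-- expression (right side) of `cfThirtyThree_step_zero4`. -/
def cfThirtyThreeFcfThirtyThree_step_zero4 : PExpr := (.leaf [])

set_option maxHeartbeats 4000000 in
/-- The defect vanishes identically at `m = 4`. -/
lemma cfThirtyThree_step_zero4 (q : ℚ) : cfThirtyThreeStep q 4 = 0 := by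
  have h := pitE 207 1 cfThirtyThreeEcfThirtyThree_step_zero4 cfThirtyThreeFcfThirtyThree_step_zero4 (by decide +kernel) (by decide +kernel) (by decide +kernel) (by decide +kernel)
  simpa [evalE, evalP, cfThirtyThreeEcfThirtyThree_step_zero4, cfThirtyThreeFcfThirtyThree_step_zero4, cfThirtyThreeStep] using h q 0

/-- expression (left side) of `cfThirtyThree_step_zero5`. -/
def cfThirtyThreeEcfThirtyThree_step_zero5 : PExpr := (.comp cfThirtyThreeStepData .va (.const (5)))

/-- expression (right side) of `cfThirtyThree_step_zero5`. -/
def cfThirtyThreeFcfThirtyThree_step_zero5 : PExpr := (.leaf [])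

set_option maxHeartbeats 4000000 in
/-- The defect vanishes identically at `m = 5`. -/
lemma cfThirtyThree_step_zero5 (q : ℚ) : cfThirtyThreeStep q 5 = 0 := by
  have h := pitE 210 1 cfThirtyThreeEcfThirtyThree_step_zero5 cfThirtyThreeFcfThirtyThree_step_zero5 (by decide +kernel) (by decide +kernel) (by decide +kernel) (by decide +kernel)
  simpa [evalE, evalP, cfThirtyThreeEcfThirtyThree_step_zero5, cfThirtyThreeFcfThirtyThree_step_zero5, cfThirtyThreeStep] using h q 0

/-- expression (left side) of `cfThirtyThree_step_zero6`. -/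
def cfThirtyThreeEcfThirtyThree_step_zero6 : PExpr := (.comp cfThirtyThreeStepData .va (.const (6)))

/-- expression (right side) of `cfThirtyThree_step_zero6`. -/
def cfThirtyThreeFcfThirtyThree_step_zero6 : PExpr := (.leaf [])

set_option maxHeartbeats 4000000 in
/-- The defect vanishes identically at `m = 6`. -/
lemma cfThirtyThree_step_zero6 (q : ℚ) : cfThirtyThreeStep q 6 = 0 := by
  have h := pitE 214 1 cfThirtyThreeEcfThirtyThree_step_zero6 cfThirtyThreeFcfThirtyThree_step_zero6 (by decide +kernel) (by decide +kernel) (by decide +kernel) (by decide +kernel)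
  simpa [evalE, evalP, cfThirtyThreeEcfThirtyThree_step_zero6, cfThirtyThreeFcfThirtyThree_step_zero6, cfThirtyThreeStep] using h q 0

/-- expression (left side) of `cfThirtyThree_step_zero7`. -/
def cfThirtyThreeEcfThirtyThree_step_zero7 : PExpr := (.comp cfThirtyThreeStepData .va (.const (7)))

/-- expression (right side) of `cfThirtyThree_step_zero7`. -/
def cfThirtyThreeFcfThirtyThree_step_zero7 : PExpr := (.leaf [])

set_option maxHeartbeats 4000000 in
/-- The defect vanishes identically at `m = 7`. -/
lemma cfThirtyThree_step_zero7 (q : ℚ) : cfThirtyThreeStep q 7 = 0 := by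
  have h := pitE 218 1 cfThirtyThreeEcfThirtyThree_step_zero7 cfThirtyThreeFcfThirtyThree_step_zero7 (by decide +kernel) (by decide +kernel) (by decide +kernel) (by decide +kernel)
  simpa [evalE, evalP, cfThirtyThreeEcfThirtyThree_step_zero7, cfThirtyThreeFcfThirtyThree_step_zero7, cfThirtyThreeStep] using h q 0

/-- expression (left side) of `cfThirtyThree_step_zero8`. -/
def cfThirtyThreeEcfThirtyThree_step_zero8 : PExpr := (.comp cfThirtyThreeStepData .va (.const (8)))

/-- expression (right side) of `cfThirtyThree_step_zero8`. -/
def cfThirtyThreeFcfThirtyThree_step_zero8 : PExpr := (.leaf [])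

set_option maxHeartbeats 4000000 in
/-- The defect vanishes identically at `m = 8`. -/
lemma cfThirtyThree_step_zero8 (q : ℚ) : cfThirtyThreeStep q 8 = 0 := by
  have h := pitE 221 1 cfThirtyThreeEcfThirtyThree_step_zero8 cfThirtyThreeFcfThirtyThree_step_zero8 (by decide +kernel) (by decide +kernel) (by decide +kernel) (by decide +kernel)
  simpa [evalE, evalP, cfThirtyThreeEcfThirtyThree_step_zero8, cfThirtyThreeFcfThirtyThree_step_zero8, cfThirtyThreeStep] using h q 0

/-- expression (left side) of `cfThirtyThree_step_zero9`. -/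
def cfThirtyThreeEcfThirtyThree_step_zero9 : PExpr := (.comp cfThirtyThreeStepData .va (.const (9)))

/-- expression (right side) of `cfThirtyThree_step_zero9`. -/
def cfThirtyThreeFcfThirtyThree_step_zero9 : PExpr := (.leaf [])

set_option maxHeartbeats 4000000 in
/-- The defect vanishes identically at `m = 9`. -/
lemma cfThirtyThree_step_zero9 (q : ℚ) : cfThirtyThreeStep q 9 = 0 := by
  have h := pitE 224 1 cfThirtyThreeEcfThirtyThree_step_zero9 cfThirtyThreeFcfThirtyThree_step_zero9 (by decide +kernel) (by decide +kernel) (by decide +kernel) (by decide +kernel)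
  simpa [evalE, evalP, cfThirtyThreeEcfThirtyThree_step_zero9, cfThirtyThreeFcfThirtyThree_step_zero9, cfThirtyThreeStep] using h q 0

/-- expression (left side) of `cfThirtyThree_step_zero10`. -/
def cfThirtyThreeEcfThirtyThree_step_zero10 : PExpr := (.comp cfThirtyThreeStepData .va (.const (10)))

/-- expression (right side) of `cfThirtyThree_step_zero10`. -/
def cfThirtyThreeFcfThirtyThree_step_zero10 : PExpr := (.leaf [])

set_option maxHeartbeats 4000000 in
/-- The defect vanishes identically at `m = 10`. -/
lemma cfThirtyThree_step_zero10 (q : ℚ) : cfThirtyThreeStep q 10 = 0 := by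
  have h := pitE 227 1 cfThirtyThreeEcfThirtyThree_step_zero10 cfThirtyThreeFcfThirtyThree_step_zero10 (by decide +kernel) (by decide +kernel) (by decide +kernel) (by decide +kernel)
  simpa [evalE, evalP, cfThirtyThreeEcfThirtyThree_step_zero10, cfThirtyThreeFcfThirtyThree_step_zero10, cfThirtyThreeStep] using h q 0

/-- expression (left side) of `cfThirtyThree_step_zero11`. -/
def cfThirtyThreeEcfThirtyThree_step_zero11 : PExpr := (.comp cfThirtyThreeStepData .va (.const (11)))

/-- expression (right side) of `cfThirtyThree_step_zero11`. -/
def cfThirtyThreeFcfThirtyThree_step_zero11 : PExpr := (.leaf [])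

set_option maxHeartbeats 4000000 in
/-- The defect vanishes identically at `m = 11`. -/
lemma cfThirtyThree_step_zero11 (q : ℚ) : cfThirtyThreeStep q 11 = 0 := by
  have h := pitE 230 1 cfThirtyThreeEcfThirtyThree_step_zero11 cfThirtyThreeFcfThirtyThree_step_zero11 (by decide +kernel) (by decide +kernel) (by decide +kernel) (by decide +kernel)
  simpa [evalE, evalP, cfThirtyThreeEcfThirtyThree_step_zero11, cfThirtyThreeFcfThirtyThree_step_zero11, cfThirtyThreeStep] using h q 0

/-- expression (left side) of `cfThirtyThree_step_zero12`. -/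
def cfThirtyThreeEcfThirtyThree_step_zero12 : PExpr := (.comp cfThirtyThreeStepData .va (.const (12)))

/-- expression (right side) of `cfThirtyThree_step_zero12`. -/
def cfThirtyThreeFcfThirtyThree_step_zero12 : PExpr := (.leaf [])

set_option maxHeartbeats 4000000 in
/-- The defect vanishes identically at `m = 12`. -/
lemma cfThirtyThree_step_zero12 (q : ℚ) : cfThirtyThreeStep q 12 = 0 := by
  have h := pitE 233 1 cfThirtyThreeEcfThirtyThree_step_zero12 cfThirtyThreeFcfThirtyThree_step_zero12 (by decide +kernel) (by decide +kernel) (by decide +kernel) (by decide +kernel)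
  simpa [evalE, evalP, cfThirtyThreeEcfThirtyThree_step_zero12, cfThirtyThreeFcfThirtyThree_step_zero12, cfThirtyThreeStep] using h q 0

/-- expression (left side) of `cfThirtyThree_step_zero13`. -/
def cfThirtyThreeEcfThirtyThree_step_zero13 : PExpr := (.comp cfThirtyThreeStepData .va (.const (13)))

/-- expression (right side) of `cfThirtyThree_step_zero13`. -/
def cfThirtyThreeFcfThirtyThree_step_zero13 : PExpr := (.leaf [])

set_option maxHeartbeats 4000000 in
/-- The defect vanishes identically at `m = 13`. -/
lemma cfThirtyThree_step_zero13 (q : ℚ) : cfThirtyThreeStep q 13 = 0 := by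
  have h := pitE 236 1 cfThirtyThreeEcfThirtyThree_step_zero13 cfThirtyThreeFcfThirtyThree_step_zero13 (by decide +kernel) (by decide +kernel) (by decide +kernel) (by decide +kernel)
  simpa [evalE, evalP, cfThirtyThreeEcfThirtyThree_step_zero13, cfThirtyThreeFcfThirtyThree_step_zero13, cfThirtyThreeStep] using h q 0

/-- expression (left side) of `cfThirtyThree_step_zero14`. -/
def cfThirtyThreeEcfThirtyThree_step_zero14 : PExpr := (.comp cfThirtyThreeStepData .va (.const (14)))

/-- expression (right side) of `cfThirtyThree_step_zero14`. -/
def cfThirtyThreeFcfThirtyThree_step_zero14 : PExpr := (.leaf [])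

set_option maxHeartbeats 4000000 in
/-- The defect vanishes identically at `m = 14`. -/
lemma cfThirtyThree_step_zero14 (q : ℚ) : cfThirtyThreeStep q 14 = 0 := by
  have h := pitE 238 1 cfThirtyThreeEcfThirtyThree_step_zero14 cfThirtyThreeFcfThirtyThree_step_zero14 (by decide +kernel) (by decide +kernel) (by decide +kernel) (by decide +kernel)
  simpa [evalE, evalP, cfThirtyThreeEcfThirtyThree_step_zero14, cfThirtyThreeFcfThirtyThree_step_zero14, cfThirtyThreeStep] using h q 0

/-- The defect vanishes for every `m < 15`. -/
lemma cfThirtyThree_step_small (q : ℚ) (m : ℕ) (hm : m < 15) : cfThirtyThreeStep q m = 0 := by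
  interval_cases m
  · exact_mod_cast cfThirtyThree_step_zero0 q
  · exact_mod_cast cfThirtyThree_step_zero1 q
  · exact_mod_cast cfThirtyThree_step_zero2 q
  · exact_mod_cast cfThirtyThree_step_zero3 q
  · exact_mod_cast cfThirtyThree_step_zero4 q
  · exact_mod_cast cfThirtyThree_step_zero5 q
  · exact_mod_cast cfThirtyThree_step_zero6 q
  · exact_mod_cast cfThirtyThree_step_zero7 q
  · exact_mod_cast cfThirtyThree_step_zero8 q
  · exact_mod_cast cfThirtyThree_step_zero9 q
  · exact_mod_cast cfThirtyThree_step_zero10 q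
  · exact_mod_cast cfThirtyThree_step_zero11 q
  · exact_mod_cast cfThirtyThree_step_zero12 q
  · exact_mod_cast cfThirtyThree_step_zero13 q
  · exact_mod_cast cfThirtyThree_step_zero14 q

/-- `C_33` is a super-solution of the recurrence (`m + 1 ≤ q`). -/
lemma cfThirtyThree_step (q : ℚ) (m : ℕ) (hq : (m : ℚ) + 1 ≤ q) :
    (2 * (m + 1) * cfThirtyThreeN q m + q * cfThirtyThreeD q m) * cfThirtyThreeD q (m + 1)
      ≤ (q + m + 1) * cfThirtyThreeN q (m + 1) * cfThirtyThreeD q m := by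
  have e := cfThirtyThree_step_eq q m
  rcases Nat.lt_or_ge m 15 with h | h
  · rw [cfThirtyThree_step_small q m h] at e
    linarith
  · have key := cfThirtyThree_step_shift (q - m - 1) ((m : ℚ) - 15)
    rw [show q - m - 1 + ((m : ℚ) - 15) + 16 = q by ring, show (m : ℚ) - 15 + 15 = m by ring] at key
    have ht : (15 : ℚ) ≤ m := by exact_mod_cast h
    have hpos := evalP_nonneg cfThirtyThreeStepAb (by decide +kernel) (q - m - 1) ((m : ℚ) - 15) (by linarith) (by linarith)
    linarith

/-- **The upper bound**: `S(q,m) ≤ C_33(q,m)` for `m + 1 ≤ q`. -/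
theorem sumS_le_cfThirtyThree (q m : ℕ) (hmq : m + 1 ≤ q) :
    sumS q m ≤ cfThirtyThreeN q m / cfThirtyThreeD q m := by
  induction m with
  | zero =>
    rw [sumS_zero, Nat.cast_zero, cfThirtyThree_zero]
    have hD := cfThirtyThreeD_pos q 0 le_rfl (by exact_mod_cast hmq)
    rw [div_self hD.ne']
  | succ m ih =>
    have ih' := ih (by omega)
    have hD := cfThirtyThreeD_pos q m (by positivity) (by exact_mod_cast (show m + 1 ≤ q by omega))
    have hD' := cfThirtyThreeD_pos q (m + 1) (by positivity) (by exact_mod_cast hmq)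
    have hrec := sumS_succ q m
    have hstep := cfThirtyThree_step q m (by exact_mod_cast (show m + 1 ≤ q by omega))
    have hqm : (0 : ℚ) < q + m + 1 := by positivity
    rw [le_div_iff₀ hD] at ih'
    push_cast
    rw [le_div_iff₀ hD']
    have hS : sumS q (m + 1) = (2 * (m + 1) * sumS q m + q) / (q + m + 1) := by
      rw [eq_div_iff hqm.ne']; linarith
    rw [hS, div_mul_eq_mul_div, div_le_iff₀ hqm]
    have h4 : 0 ≤ 2 * ((m : ℚ) + 1) * cfThirtyThreeD q (m + 1) * (cfThirtyThreeN q m - sumS q m * cfThirtyThreeD q m) :=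
      mul_nonneg (by positivity) (by linarith)
    have h5 : cfThirtyThreeD q m * ((2 * (m + 1) * sumS q m + q) * cfThirtyThreeD q (m + 1))
        ≤ cfThirtyThreeD q m * (cfThirtyThreeN q (m + 1) * (q + m + 1)) := by
      nlinarith [hstep, h4]
    exact le_of_mul_le_mul_left h5 hD

end PercRepro
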